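import Mathlib.Algebra.MvPolynomial.Eval
import Literature.Computability.AlgebraicComplexity.BrentTorusWeights
import HarnessLib

/-!
# `HasNSRefutation`: Nullstellensatz refutations with multipliers of bounded degree

Topic: `Literature/Computability/AlgebraicComplexity`. This file answers the definition request
`defn-HasNSRefutation` (route MatrixMultiplication/BrentRefutationDepth, items
`stmt-MatrixMultiplication-5580…5588`) under the REQUESTED NAME. The request asked for two
definitions: (1) the Brent system `brentSystem K n r` — landed in `BrentEquations.lean` — and
(2) `HasNSRefutation (S : ι → MvPolynomial σ K) (D : ℕ) : Prop :=
∃ g, (∀ e, (g e).totalDegree ≤ D) ∧ ∑ e, g e * S e = 1` ("Nullstellensatz refutation with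
multipliers of total degree `≤ D`", Krajíček, *Proof Complexity* §6.2, multiplier-degree
convention). The mathematical content of (2) already lives in the tree as the general notion
`Literature.Computability.Complexity.HasNSRefutationWithMultipliersOfDegree`
(`Complexity/NullstellensatzRefutation.lean`: finitely supported multipliers, no `Fintype`
hypothesis), so — one notion, not two — `HasNSRefutation` is declared here as a REDUCIBLE
ABBREVIATION of that notion, and the requested `Fintype`-indexed body is its unfolding lemma
`hasNSRefutation_iff`. Every lemma of the tree stated for
`HasNSRefutationWithMultipliersOfDegree` (`.mono`, `.exists_eval_ne_zero`, `.one_mem_span`,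
`.exists_forall_isWeightedHomogeneous_zero`, …) applies verbatim to `h : HasNSRefutation S D`.

## What is here (all proved; no named facts)

* `HasNSRefutation S D` (abbrev) with `hasNSRefutation_def` (Finset form, `Iff.rfl`),
  `hasNSRefutation_iff` (the requested form `∃ g, (∀ e, deg g e ≤ D) ∧ ∑ e, g e * S e = 1`),
  the constructor `HasNSRefutation.of_forall`, `HasNSRefutation.mono`.
* The four "wanted lemmas" of the request: **soundness**
  `HasNSRefutation.forall_exists_eval_ne_zero : HasNSRefutation S D → ∀ x, ∃ e, eval x (S e) ≠ 0`
  (and `not_hasNSRefutation_of_eval_eq_zero`, the algebra form `….forall_exists_aeval_ne_zero`);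
  **Brent systems** `HasNSRefutation.lt_tensorRank_matMulTensor :
  HasNSRefutation (fun e => brentSystem K n r e.1 e.2.1 e.2.2) D → r < R(⟨n,n,n⟩)` (= route item
  `RefutationSound`), with `hasBrentRefutation_iff_hasNSRefutation : HasBrentRefutation K n r D ↔
  HasNSRefutation (uncurried brentSystem) D` (`Iff.rfl`) and the route's curried form
  `hasNSRefutation_brentSystem_iff`; **monotonicity** in `D`; **torus invariance**
  `hasNSRefutation_brentSystem_iff_exists_torusInvariant` (weight-`0` projection does not raise
  the degree; general graded form `HasNSRefutation.exists_weightZero`).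
* New small API: **change of scalars** `HasNSRefutation.map` (a refutation over `K` maps to one
  over `L` along any ring hom `K →+* L`, degrees do not grow), `map_brentSystem`
  (`B(n, r)` has coefficients `0, ±1`), hence `HasBrentRefutation.map / .of_int / .of_algebraMap`:
  a certificate found by exact linear algebra over `ℤ` or `ℚ` proves the route's statements over
  `ℂ`; the degree-free content `exists_hasNSRefutation_iff_one_mem_span` (`1 ∈ (S)`), and the
  conversion to Krajíček's product-degree convention `HasNSRefutation.hasNSRefutationOfDegree`.

## References

* J. Krajíček, *Proof Complexity*, Encyclopedia Math. Appl. 170, CUP 2019, §6.2 (the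
  Nullstellensatz proof system: `∑ h_f f = 1`, soundness and completeness, degree).
  [KrajicekProofComplexity2019]
* M. J. H. Heule, M. Kauers, M. Seidl, *New ways to multiply 3 × 3-matrices*, J. Symbolic Comput.
  104 (2021) 899–916, §2 (the Brent equations). [HeuleKauersSeidl2021]

## Design choices; not here

* `abbrev`, not a second `def`: the tree keeps ONE notion of multiplier-degree NS refutation; the
  requested short name is the alias. No `[Fintype ι]` on the abbreviation (free generality); the
  `Fintype` form is `hasNSRefutation_iff`.
* Not here: PC (dynamic) degree, SOS/Positivstellensatz refutations (`Complexity/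
  SumOfSquaresRefutation.lean`), degree LOWER bounds, any concrete certificate.
-/

noncomputable section

open MvPolynomial Finset
open Literature.Computability.Complexity

namespace Literature.Computability.AlgebraicComplexity

universe u

/-! ## The notion -/

section General

variable {ι σ K : Type*} [CommRing K]

/-- **Nullstellensatz refutation with multipliers of total degree `≤ D`** of the polynomial system
`{S e = 0}_e`: finitely many multipliers `g e` with `∑_e g e · S e = 1` (an NS-proof of `1`,
Krajíček 2019, §6.2, eq. (6.2.2) with `g = 1`) and `deg (g e) ≤ D` — the degree measured on the
MULTIPLIERS, the convention of route MatrixMultiplication/BrentRefutationDepth (Krajíček's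
`deg(π) = max deg(h_f f)` is `HasNSRefutationOfDegree`; conversion
`HasNSRefutation.hasNSRefutationOfDegree`). This is the tree's
`Literature.Computability.Complexity.HasNSRefutationWithMultipliersOfDegree` under the requested
name (a reducible abbreviation — one notion); for a finite index type it reads
`∃ g, (∀ e, deg (g e) ≤ D) ∧ ∑ e, g e * S e = 1` (`hasNSRefutation_iff`).
[cite: KrajicekProofComplexity2019, §6.2 eq. (6.2.2)] -/
abbrev HasNSRefutation (S : ι → MvPolynomial σ K) (D : ℕ) : Prop :=
  HasNSRefutationWithMultipliersOfDegree S D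

/-- Unfolding (finitely supported multipliers). [cite: KrajicekProofComplexity2019, §6.2] -/
theorem hasNSRefutation_def (S : ι → MvPolynomial σ K) (D : ℕ) :
    HasNSRefutation S D ↔ ∃ (s : Finset ι) (g : ι → MvPolynomial σ K),
      (∑ e ∈ s, g e * S e) = 1 ∧ ∀ e ∈ s, (g e).totalDegree ≤ D :=
  Iff.rfl

/-- **The requested form**: for a finitely indexed system, `HasNSRefutation S D` iff there are
multipliers `g : ι → K[σ]`, all of total degree `≤ D`, with `∑ e, g e * S e = 1`.
[cite: KrajicekProofComplexity2019, §6.2] -/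
theorem hasNSRefutation_iff [Fintype ι] (S : ι → MvPolynomial σ K) (D : ℕ) :
    HasNSRefutation S D ↔
      ∃ g : ι → MvPolynomial σ K, (∀ e, (g e).totalDegree ≤ D) ∧ (∑ e, g e * S e) = 1 :=
  hasNSRefutationWithMultipliersOfDegree_iff_forall S D

/-- Constructor: an explicit certificate `(g, ∑ g e * S e = 1)` of multiplier degree `≤ D`.
[folklore] -/
theorem HasNSRefutation.of_forall [Fintype ι] {S : ι → MvPolynomial σ K} {D : ℕ}
    (g : ι → MvPolynomial σ K) (hdeg : ∀ e, (g e).totalDegree ≤ D) (hsum : (∑ e, g e * S e) = 1) :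
    HasNSRefutation S D :=
  (hasNSRefutation_iff S D).2 ⟨g, hdeg, hsum⟩

/-- Monotonicity in the degree bound. [folklore] -/
theorem HasNSRefutation.mono {S : ι → MvPolynomial σ K} {D D' : ℕ} (h : HasNSRefutation S D)
    (hD : D ≤ D') : HasNSRefutation S D' :=
  HasNSRefutationWithMultipliersOfDegree.mono h hD

/-- **Soundness** (the wanted form): a refuted system has no common zero over the (nontrivial)
coefficient ring — at every point some equation fails (evaluate `∑ g e · S e = 1`: `0 = 1`).
[cite: KrajicekProofComplexity2019, §6.2 (NS is sound)] -/
theorem HasNSRefutation.forall_exists_eval_ne_zero [Nontrivial K] {S : ι → MvPolynomial σ K}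
    {D : ℕ} (h : HasNSRefutation S D) : ∀ x : σ → K, ∃ e, eval x (S e) ≠ 0 :=
  fun x => HasNSRefutationWithMultipliersOfDegree.exists_eval_ne_zero h x

/-- Soundness, contrapositive: a system with a common zero has no NS refutation in any degree.
[cite: KrajicekProofComplexity2019, §6.2 (NS is sound)] -/
theorem not_hasNSRefutation_of_eval_eq_zero [Nontrivial K] {S : ι → MvPolynomial σ K}
    (x : σ → K) (hx : ∀ e, eval x (S e) = 0) (D : ℕ) : ¬ HasNSRefutation S D :=
  fun h => by
    obtain ⟨e, he⟩ := h.forall_exists_eval_ne_zero x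
    exact he (hx e)

/-- Soundness in algebras: no common zero in any nontrivial commutative `K`-algebra `L` (so a
rational certificate excludes complex solutions). [cite: KrajicekProofComplexity2019, §6.2 (NS is sound)] -/
theorem HasNSRefutation.forall_exists_aeval_ne_zero {L : Type*} [CommRing L] [Algebra K L]
    [Nontrivial L] {S : ι → MvPolynomial σ K} {D : ℕ} (h : HasNSRefutation S D) :
    ∀ x : σ → L, ∃ e, aeval x (S e) ≠ 0 :=
  fun x => HasNSRefutationWithMultipliersOfDegree.exists_aeval_ne_zero h x

/-- **Change of scalars**: mapping a refutation along a ring homomorphism `f : K →+* L` gives a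
refutation of the mapped system with multipliers of no larger degree (`map f` is a ring hom and
does not enlarge supports). [folklore] -/
theorem HasNSRefutation.map {L : Type*} [CommRing L] (f : K →+* L) {S : ι → MvPolynomial σ K}
    {D : ℕ} (h : HasNSRefutation S D) :
    HasNSRefutation (fun e => MvPolynomial.map f (S e)) D := by
  obtain ⟨s, g, hsum, hdeg⟩ := h
  refine ⟨s, fun e => MvPolynomial.map f (g e), ?_,
    fun e he => (Finset.sup_mono (support_map_subset f (g e))).trans (hdeg e he)⟩
  have h1 := congrArg (MvPolynomial.map f) hsum
  rw [map_sum, map_one] at h1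
  simpa only [map_mul] using h1

/-- The degree-free content of an NS refutation is ideal membership: refutable in SOME degree iff
`1 ∈ (S e : e)`. [cite: KrajicekProofComplexity2019, §6.2 (NS is sound and complete)] -/
theorem exists_hasNSRefutation_iff_one_mem_span (S : ι → MvPolynomial σ K) :
    (∃ D, HasNSRefutation S D) ↔ (1 : MvPolynomial σ K) ∈ Ideal.span (Set.range S) :=
  exists_hasNSRefutationWithMultipliersOfDegree_iff_one_mem_span S

/-- Conversion to Krajíček's degree of an NS proof (bound on the PRODUCTS `g e · S e`):
multipliers of degree `≤ D` against axioms of degree `≤ k` give an NS refutation of degree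
`≤ D + k`. [cite: KrajicekProofComplexity2019, §6.2 (degree of an NS-proof)] -/
theorem HasNSRefutation.hasNSRefutationOfDegree {S : ι → MvPolynomial σ K} {D k : ℕ}
    (h : HasNSRefutation S D) (hk : ∀ e, (S e).totalDegree ≤ k) :
    HasNSRefutationOfDegree S (D + k) :=
  hasNSRefutationOfDegree_of_multipliers h hk

variable {M : Type*} [AddCommMonoid M]

/-- **Weight-zero projection** for a grading `w : σ → M` under which every axiom is
weighted-homogeneous of weight `0` (e.g. a torus acting diagonally): a refutation may be taken
with weight-`0` (invariant) multipliers of the same degree bound. [folklore] -/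
theorem HasNSRefutation.exists_weightZero [Fintype ι] (w : σ → M) {S : ι → MvPolynomial σ K}
    {D : ℕ} (hS : ∀ e, IsWeightedHomogeneous w (S e) 0) (h : HasNSRefutation S D) :
    ∃ g : ι → MvPolynomial σ K, (∀ e, IsWeightedHomogeneous w (g e) 0) ∧
      (∀ e, (g e).totalDegree ≤ D) ∧ (∑ e, g e * S e) = 1 :=
  HasNSRefutationWithMultipliersOfDegree.exists_forall_isWeightedHomogeneous_zero w hS h

/-- Weight-zero projection, `iff` form: for weight-`0` systems, refutability in multiplier degree
`D` is refutability by weight-`0` multipliers of degree `≤ D`. [folklore] -/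
theorem hasNSRefutation_iff_exists_weightZero [Fintype ι] (w : σ → M) {S : ι → MvPolynomial σ K}
    (hS : ∀ e, IsWeightedHomogeneous w (S e) 0) (D : ℕ) :
    HasNSRefutation S D ↔ ∃ g : ι → MvPolynomial σ K, (∀ e, IsWeightedHomogeneous w (g e) 0) ∧
      (∀ e, (g e).totalDegree ≤ D) ∧ (∑ e, g e * S e) = 1 :=
  hasNSRefutationWithMultipliersOfDegree_iff_exists_isWeightedHomogeneous_zero w hS D

end General

/-! ## Brent systems -/

section Brent

variable {K : Type u} [CommRing K]

/-- `HasBrentRefutation K n r D` (`BrentEquations.lean`) IS `HasNSRefutation` of the Brent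
system `B(n, r)` indexed by triples `(i, j, k)` — definitionally. [folklore] -/
theorem hasBrentRefutation_iff_hasNSRefutation (n r D : ℕ) :
    HasBrentRefutation K n r D ↔
      HasNSRefutation (fun e : (Fin n × Fin n) × (Fin n × Fin n) × (Fin n × Fin n) =>
        brentSystem K n r e.1 e.2.1 e.2.2) D :=
  Iff.rfl

/-- **The route's inline (curried) form**: an NS refutation of `B(n, r)` with multipliers of
degree `≤ D` iff `∃ g, (∀ i j k, deg (g i j k) ≤ D) ∧ ∑ i, ∑ j, ∑ k, g i j k * B_{ijk} = 1` —
after `brentSystem_apply`, literally the shape of the items of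
MatrixMultiplication/BrentRefutationDepth. [folklore] -/
theorem hasNSRefutation_brentSystem_iff (n r D : ℕ) :
    HasNSRefutation (fun e : (Fin n × Fin n) × (Fin n × Fin n) × (Fin n × Fin n) =>
        brentSystem K n r e.1 e.2.1 e.2.2) D ↔
      ∃ g : (Fin n × Fin n) → (Fin n × Fin n) → (Fin n × Fin n) →
          MvPolynomial (Fin 3 × Fin r × (Fin n × Fin n)) K,
        (∀ i j k, (g i j k).totalDegree ≤ D) ∧
          (∑ i, ∑ j, ∑ k, g i j k * brentSystem K n r i j k) = 1 :=
  hasBrentRefutation_iff K n r D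

/-- **Refutations of Brent systems certify rank lower bounds** (wanted lemma; route item
`RefutationSound`): an NS refutation of `B(n, r)` over a nontrivial `K`, in any multiplier
degree, gives `r < R_K(⟨n,n,n⟩)` (a decomposition with `≤ r` triads, padded, would be a common
zero). [cite: HeuleKauersSeidl2021, §2 (the Brent equations)] -/
theorem HasNSRefutation.lt_tensorRank_matMulTensor [Nontrivial K] {n r D : ℕ}
    (h : HasNSRefutation (fun e : (Fin n × Fin n) × (Fin n × Fin n) × (Fin n × Fin n) =>
      brentSystem K n r e.1 e.2.1 e.2.2) D) :
    r < tensorRank (matMulTensor K n n n) :=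
  HasBrentRefutation.lt_tensorRank h

/-- **Torus invariance** (wanted lemma): `B(n, r)` is refutable with multipliers of degree `≤ D`
iff it is refutable with multipliers of degree `≤ D` that are invariant (weight `0`) under the
rescaling torus `(Kˣ)^r × (Kˣ)^r` — the weight-`0` projection of a certificate is a certificate
and does not raise degrees. [folklore] -/
theorem hasNSRefutation_brentSystem_iff_exists_torusInvariant (n r D : ℕ) :
    HasNSRefutation (fun e : (Fin n × Fin n) × (Fin n × Fin n) × (Fin n × Fin n) =>
        brentSystem K n r e.1 e.2.1 e.2.2) D ↔
      ∃ g : (Fin n × Fin n) × (Fin n × Fin n) × (Fin n × Fin n) →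
          MvPolynomial (Fin 3 × Fin r × (Fin n × Fin n)) K,
        (∀ e, IsWeightedHomogeneous (brentTorusWeight n r) (g e) 0) ∧
          (∀ e, (g e).totalDegree ≤ D) ∧ (∑ e, g e * brentSystem K n r e.1 e.2.1 e.2.2) = 1 :=
  hasBrentRefutation_iff_exists_torusInvariant n r D

/-- **`B(n, r)` is defined over `ℤ`**: its coefficients are `0, ±1`, so it is mapped to itself by
every ring homomorphism `f : K →+* L` (`map f (X v) = X v`, and `f` fixes the `0/1` entries of
`⟨n,n,n⟩`). [cite: HeuleKauersSeidl2021, §2 (the Brent equations)] -/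
theorem map_brentSystem {L : Type*} [CommRing L] (f : K →+* L) (n r : ℕ) (i j k : Fin n × Fin n) :
    MvPolynomial.map f (brentSystem K n r i j k) = brentSystem L n r i j k := by
  have hmm : f (matMulTensor K n n n i j k) = matMulTensor L n n n i j k := by
    simp only [matMulTensor]
    split_ifs <;> simp
  simp only [brentSystem, map_sub, map_sum, map_mul, map_X, map_C, hmm]

/-- **Certificates transfer along ring homomorphisms**: an NS refutation of `B(n, r)` over `K`
gives one over `L` of the same multiplier degree, for any `f : K →+* L`. [folklore] -/
theorem HasBrentRefutation.map {L : Type*} [CommRing L] (f : K →+* L) {n r D : ℕ}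
    (h : HasBrentRefutation K n r D) : HasBrentRefutation L n r D := by
  have h' := HasNSRefutation.map f h
  simp only [map_brentSystem] at h'
  exact h'

/-- In particular an integral certificate refutes `B(n, r)` over every commutative ring.
[folklore] -/
theorem HasBrentRefutation.of_int {n r D : ℕ} (h : HasBrentRefutation ℤ n r D) :
    HasBrentRefutation K n r D :=
  h.map (Int.castRingHom K)

/-- And a certificate over `R` (e.g. `ℚ`, found by exact linear algebra) refutes `B(n, r)` over
every `R`-algebra (e.g. `ℂ`, the coefficient field of route BrentRefutationDepth). [folklore] -/
theorem HasBrentRefutation.of_algebraMap {R : Type*} [CommRing R] [Algebra R K] {n r D : ℕ}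
    (h : HasBrentRefutation R n r D) : HasBrentRefutation K n r D :=
  h.map (algebraMap R K)

end Brent

end Literature.Computability.AlgebraicComplexity

end
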